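import Summits.ABC.ABC.Theorems.TwistAmplificationMazurKaneLawRecordDefs
import Summits.ABC.ABC.Theorems.TwistAmplificationMazurKaneLawToolkitCertifiedLaw
import Literature.NumberTheory.DiophantineGeometry.AbcShapeLPInstance

-- `Summit.ABC.ABC` is the mandated summit-side namespace (single-conjunct summit); the lakefile sets the same option.
set_option linter.dupNamespace false

/-!
# Crux `TwistAmplification.MazurKaneLaw` (stmt-ABC-2757), line `fibre-toolkit-lp-wall-map`: the J-generic dictionary theorem

Record pipeline v2 (lead c2).  Lead c1's records (`recordInstance_R74/R32/R1p`) instantiate the exponent dictionary by hand,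
once per number of explicit levels `J` and once per tool list of the generated LP lemma.  This file proves the dictionary ONCE,
for every `J`: if the PURE-REAL linear programme in `J` explicit levels — variables `a b c : Fin J → ℝ` (exponents of the first
`J` coordinates of the three terms), totals `A B C`, deficits `da db dc`, the log-count `D` and a slack `σ ∈ [0, 1/1000]`, with
the structural inequalities and the five tool FAMILIES (trivial; determinant at every level `2 ≤ k+1 ≤ J`; Fourier with saved
finsets; subset geometry of numbers over arbitrary finsets `I J K ⊆ Fin J`; square-root lattice over arbitrary host finsets
`H ⊆ Fin J`, three hosts) quantified over their index data — implies `D ≤ Vc + σ`, then `RecordInstance J s₀ Vc` holds.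
A record at `(J, s₀, Vc)` is thereafter ONE generated file (the LP lemma, `linarith` cover tree, instantiating only the family
members it uses) plus `recordInstance_of_lp J s₀ Vc`, `shapeCount_le_of_recordInstance`, `recordAt_of_shapeBound`.
-/

noncomputable section

open Finset
open Literature.NumberTheory.DiophantineGeometry
open Literature.NumberTheory.DiophantineGeometry.AbcShapes

namespace Summit.ABC.ABC.Theorems.MazurKaneLaw

open Summit.ABC.ABC.Theorems.MazurKaneLaw.Toolkit

/-- `Σᵢ f i` over `Fin (J + e)` dominates the sum of the first `J` terms `f (Fin.castAdd e k)` when `f ≥ 0`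
(generic-`J` form of `castAdd_four_le_sum`). [folklore] -/
theorem sum_castAdd_le_sum {J e : ℕ} {f : Fin (J + e) → ℝ} (hf : ∀ i, 0 ≤ f i) :
    ∑ k : Fin J, f (Fin.castAdd e k) ≤ ∑ i, f i := by
  -- adapted from `castAdd_four_le_sum` (TwistAmplificationMazurKaneLawRecordInstanceR32.lean)
  rw [Fin.sum_univ_add]
  exact le_add_of_nonneg_right (sum_nonneg fun i _ => hf (Fin.natAdd J i))

/-- The weighted constraint `Σᵢ (i+1) f i ≤ L` over `Fin (J + e)` gives, for `f ≥ 0`,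
`(J+1) Σᵢ f i − L ≤ Σ_{k<J} (J − k) f (Fin.castAdd e k)`: on the head `(J+1) f_k − (k+1) f_k = (J−k) f_k`, and the
tail `i = J + i'` carries weight `J + i' + 1 ≥ J + 1` (generic-`J` form of `five_mul_sum_sub_le_castAdd`). [folklore] -/
theorem succ_mul_sum_sub_le_sum_castAdd {J e : ℕ} {f : Fin (J + e) → ℝ} {L : ℝ} (hf : ∀ i, 0 ≤ f i)
    (h : ∑ i : Fin (J + e), ((i : ℕ) + 1 : ℝ) * f i ≤ L) :
    ((J : ℝ) + 1) * ∑ i, f i - L ≤ ∑ k : Fin J, ((J : ℝ) - ((k : ℕ) : ℝ)) * f (Fin.castAdd e k) := by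
  -- adapted from `five_mul_sum_sub_le_castAdd` (TwistAmplificationMazurKaneLawRecordInstanceR32.lean)
  rw [Fin.sum_univ_add] at h ⊢
  have hhead : ∀ k : Fin J, ((J : ℝ) - ((k : ℕ) : ℝ)) * f (Fin.castAdd e k) =
      ((J : ℝ) + 1) * f (Fin.castAdd e k) -
        (((Fin.castAdd e k : Fin (J + e)) : ℕ) + 1 : ℝ) * f (Fin.castAdd e k) := by
    intro k
    rw [Fin.val_castAdd]
    ring
  have htail : ∀ i : Fin e, ((J : ℝ) + 1) * f (Fin.natAdd J i) ≤
      (((Fin.natAdd J i : Fin (J + e)) : ℕ) + 1 : ℝ) * f (Fin.natAdd J i) := by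
    intro i
    refine mul_le_mul_of_nonneg_right ?_ (hf _)
    rw [Fin.val_natAdd, Nat.cast_add]
    linarith only [Nat.cast_nonneg (α := ℝ) (i : ℕ)]
  rw [sum_congr rfl fun k _ => hhead k, sum_sub_distrib, ← mul_sum]
  have ht := sum_le_sum fun i (_ : i ∈ (univ : Finset (Fin e))) => htail i
  rw [← mul_sum] at ht
  linarith only [h, ht]

/-- `Σ_{i<n} (i + 1) = n (n + 1) / 2` in `ℝ` (Gauss). [folklore] -/
theorem sum_range_natCast_succ (n : ℕ) : ∑ i ∈ range n, ((i : ℝ) + 1) = (n : ℝ) * ((n : ℝ) + 1) / 2 := by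
  induction n with
  | zero => simp
  | succ n ih => rw [sum_range_succ, ih]; push_cast; ring

/-- The weights `k + 1` of any set of levels `S ⊆ Fin J` sum to at most `J (J + 1) / 2`. [folklore] -/
theorem sum_natCast_succ_le {J : ℕ} (S : Finset (Fin J)) :
    ∑ k ∈ S, (((k : ℕ) : ℝ) + 1) ≤ (J : ℝ) * ((J : ℝ) + 1) / 2 := by
  calc ∑ k ∈ S, (((k : ℕ) : ℝ) + 1) ≤ ∑ k : Fin J, (((k : ℕ) : ℝ) + 1) :=
        sum_le_sum_of_subset_of_nonneg (subset_univ S) fun i _ _ => by positivity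
    _ = ∑ i ∈ range J, ((i : ℝ) + 1) := Fin.sum_univ_eq_sum_range (fun i => (i : ℝ) + 1) J
    _ = (J : ℝ) * ((J : ℝ) + 1) / 2 := sum_range_natCast_succ J

/-- The structural facts of one term `W` with coefficient `c` and `c · shapeVal W ≤ Λ = 2C₀` in dimension
`J + e`, in the LP variables `w = log_Λ W`, `S = Σᵢ wᵢ`, `d_w = 1 − log_Λ(c · shapeVal W)` and the first `J`
coordinates `Fin.castAdd e k`: `w ≥ 0`, `Σ_{k<J} w_k ≤ S`, `0 ≤ d_w ≤ 1` and
`(J+1) S − Σ_{k<J} (J − k) w_k ≤ log_Λ(shapeVal W) ≤ 1 − d_w` (`log_Λ shapeVal W = Σ (i+1) wᵢ`; generic-`J` form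
of `term_facts_four`). [folklore] -/
theorem term_facts_castAdd {J e c C₀ : ℕ} (hc : 0 < c) {W : Fin (J + e) → ℕ} (hW : ∀ i, 0 < W i) {Λ : ℝ}
    (hΛ : 1 < Λ) (hΛC : Λ = 2 * C₀) (hv : c * shapeVal W ≤ 2 * C₀) {w : Fin (J + e) → ℝ} (hw : expo Λ W = w)
    {S dw : ℝ} (hS : ∑ i, w i = S) (hdw : Real.logb Λ ((c * shapeVal W : ℕ) : ℝ) = 1 - dw) :
    (∀ i, 0 ≤ w i) ∧ ∑ k : Fin J, w (Fin.castAdd e k) ≤ S ∧ 0 ≤ dw ∧ dw ≤ 1 ∧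
      ((J : ℝ) + 1) * S - ∑ k : Fin J, ((J : ℝ) - ((k : ℕ) : ℝ)) * w (Fin.castAdd e k) ≤ 1 - dw := by
  -- adapted from `term_facts_four` (TwistAmplificationMazurKaneLawRecordInstanceR32.lean)
  subst hw hS
  have hw0 : ∀ i, 0 ≤ expo Λ W i := expo_nonneg hΛ hW
  have hcv : 0 < c * shapeVal W := Nat.mul_pos hc (shapeVal_pos hW)
  have hd1 : Real.logb Λ ((c * shapeVal W : ℕ) : ℝ) ≤ 1 := by
    calc Real.logb Λ ((c * shapeVal W : ℕ) : ℝ) ≤ Real.logb Λ ((2 * C₀ : ℕ) : ℝ) := logb_natMono hΛ hcv hv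
      _ = 1 := by push_cast; rw [← hΛC]; exact Real.logb_self_eq_one hΛ
  have hd0 : 0 ≤ Real.logb Λ ((c * shapeVal W : ℕ) : ℝ) :=
    Real.logb_nonneg hΛ (by exact_mod_cast Nat.one_le_iff_ne_zero.mpr hcv.ne')
  have hle : ∑ i : Fin (J + e), ((i : ℕ) + 1 : ℝ) * expo Λ W i ≤ Real.logb Λ ((c * shapeVal W : ℕ) : ℝ) := by
    rw [← logb_shapeVal hW]
    exact logb_natMono hΛ (shapeVal_pos hW) (Nat.le_mul_of_pos_left _ hc)
  rw [hdw] at hd0 hd1 hle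
  have h5 := succ_mul_sum_sub_le_sum_castAdd hw0 hle
  exact ⟨hw0, sum_castAdd_le_sum hw0, by linarith, by linarith, by linarith⟩

/-- **The J-generic dictionary theorem** (registered sub-goal `recordInstance_of_lp` of crux stmt-ABC-2757): a proof of the
pure-real linear programme in `J ≥ 1` explicit levels (structure + the five tool families, slack `σ ≤ 1/1000`) with conclusion
`D ≤ Vc + σ` yields `RecordInstance J s₀ Vc`.  With `Λ = 2C₀`, `a k = log_Λ X (Fin.castAdd e k)` etc., `A = Σᵢ log_Λ Xᵢ` (all
`J + e` coordinates), `da = 1 − log_Λ(c₁ · shapeVal X)`, `D = log_Λ B_d`, `σ = recordSlack J (J+e) Λ Dτ P₀ t s₀`; the families are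
`AbcShapes.trivial_linear`, `det_linear` (from the determinant tool beyond `P₀`), `AbcShapes.fourier_linear`,
`AbcShapes.geometry_disjunction` and `sqrtLattice_linear` (hosts `x`, `y` via `shapeCount_swap`, `z`), on finsets mapped along
`Fin.castAdd e`; every dictionary loss is `≤ σ`.  Pattern: `recordInstance_R32`. -/
theorem recordInstance_of_lp : ∀ (J : ℕ) (s₀ Vc : ℝ), 1 ≤ J →
    (∀ (a b c : Fin J → ℝ) (A B C D da db dc σ : ℝ),
      (∀ k, 0 ≤ a k) → (∀ k, 0 ≤ b k) → (∀ k, 0 ≤ c k) →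
      ∑ k, a k ≤ A → ∑ k, b k ≤ B → ∑ k, c k ≤ C →
      ((J : ℝ) + 1) * A - ∑ k : Fin J, ((J : ℝ) - ((k : ℕ) : ℝ)) * a k ≤ 1 - da → 0 ≤ da → da ≤ 1 →
      ((J : ℝ) + 1) * B - ∑ k : Fin J, ((J : ℝ) - ((k : ℕ) : ℝ)) * b k ≤ 1 - db → 0 ≤ db → db ≤ 1 →
      ((J : ℝ) + 1) * C - ∑ k : Fin J, ((J : ℝ) - ((k : ℕ) : ℝ)) * c k ≤ 1 - dc → 0 ≤ dc → dc ≤ σ →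
      0 ≤ σ → σ ≤ 1 / 1000 → A + B + C ≤ s₀ + σ →
      D ≤ A + B + σ → D ≤ A + C + σ → D ≤ B + C + σ →
      (∀ k : Fin J, 1 ≤ (k : ℕ) →
        D ≤ A + B + C - (a k + b k + c k) + σ ∨
        D ≤ A + B + C - 1 + ((((k : ℕ) : ℝ) - 1) * (a k + b k + c k) + (da + db + dc)) / 3 + σ) →
      (∀ (SU SV SW : Finset (Fin J)) (eU eV eW : ℕ), 2 ≤ eU → 2 ≤ eV → 2 ≤ eW →
        (∀ k ∈ SU, eU ∣ (k : ℕ) + 1) → (∀ k ∈ SV, eV ∣ (k : ℕ) + 1) → (∀ k ∈ SW, eW ∣ (k : ℕ) + 1) →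
        ∑ k ∈ SU, a k + ∑ k ∈ SV, b k + ∑ k ∈ SW, c k ≤ 4 * (A + B + C) - 6 * D + σ) →
      (∀ (I J' K : Finset (Fin J)),
        ∑ k ∈ I, a k + ∑ k ∈ J', b k + ∑ k ∈ K, c k ≤ A + B + C - D + σ ∨
        1 - (∑ k ∈ I, ((k : ℕ) : ℝ) * a k + ∑ k ∈ J', ((k : ℕ) : ℝ) * b k + ∑ k ∈ K, ((k : ℕ) : ℝ) * c k) ≤
          A + B + C - D + σ) →
      (∀ (H : Finset (Fin J)) (k : Fin J), 1 ≤ (k : ℕ) →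
        D ≤ A + B + C - (1 - da) + ∑ j ∈ H, ((j : ℕ) : ℝ) * a j + σ ∨
        D ≤ A + B + C - (∑ j ∈ H, a j + b k + c k) + σ) →
      (∀ (H : Finset (Fin J)) (k : Fin J), 1 ≤ (k : ℕ) →
        D ≤ A + B + C - (1 - db) + ∑ j ∈ H, ((j : ℕ) : ℝ) * b j + σ ∨
        D ≤ A + B + C - (∑ j ∈ H, b j + a k + c k) + σ) →
      (∀ (H : Finset (Fin J)) (k : Fin J), 1 ≤ (k : ℕ) →
        D ≤ A + B + C - (1 - dc) + ∑ j ∈ H, ((j : ℕ) : ℝ) * c j + σ ∨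
        D ≤ A + B + C - (∑ j ∈ H, c j + a k + b k) + σ) →
      D ≤ Vc + σ) →
    Summit.ABC.ABC.Theorems.MazurKaneLaw.Toolkit.RecordInstance J s₀ Vc := by
  intro J s₀ Vc hJ hlp e c₁ c₂ c₃ C₀ hc₁ hc₂ hc₃ hC₀ X Y Z hX hY hZ T Dτ hTX hTY hTZ hD hC₀le hvX hvY hvZ t hP hB0
    P₀ hP₀ hdet hQX hQZ hσm
  classical
  obtain ⟨Λ, hΛdef⟩ : ∃ Λ : ℝ, Λ = 2 * C₀ := ⟨_, rfl⟩
  rw [← hΛdef] at hP hσm ⊢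
  obtain ⟨σ, hσdef⟩ : ∃ σ : ℝ, recordSlack J (J + e) Λ Dτ P₀ t s₀ = σ := ⟨_, rfl⟩
  rw [hσdef] at hσm ⊢
  /- positivity of the scale and of the loss terms; the slack -/
  have hC₀' : (1 : ℝ) ≤ C₀ := by exact_mod_cast hC₀
  have hΛ : 1 < Λ := by rw [hΛdef]; linarith only [hC₀']
  have hΛ0 : 0 < Λ := by linarith only [hΛ]
  have hDτ : 1 ≤ Dτ := by
    have h1 : (1 : ℕ) ≤ T :=
      le_trans (Nat.mul_pos hc₃ (shapeVal_pos fun i => Nat.mul_pos two_pos (hZ i))) hTZ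
    simpa using hD 1 one_ne_zero h1
  have hBr : (0 : ℝ) < shapeCount c₁ c₂ c₃ X Y Z := by exact_mod_cast hB0
  have he0 : (0 : ℝ) ≤ (e : ℝ) := Nat.cast_nonneg _
  have hJ1 : (1 : ℝ) ≤ (J : ℝ) := by exact_mod_cast hJ
  have hdd : ((J + e : ℕ) : ℝ) = (J : ℝ) + (e : ℝ) := Nat.cast_add J e
  have hlD0 : 0 ≤ Real.logb Λ Dτ := Real.logb_nonneg hΛ (by exact_mod_cast hDτ)
  have hV2pos : 0 < shapeVal (fun _ : Fin (J + e) => 2) := shapeVal_pos fun _ => two_pos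
  have hlV0 : 0 ≤ Real.logb Λ ((shapeVal (fun _ : Fin (J + e) => 2) : ℕ) : ℝ) :=
    Real.logb_nonneg hΛ (by exact_mod_cast Nat.one_le_iff_ne_zero.mpr hV2pos.ne')
  obtain ⟨hl20, hl27, hl48, hl114⟩ : 0 ≤ Real.logb Λ 2 ∧ 0 ≤ Real.logb Λ 27 ∧ 0 ≤ Real.logb Λ 48 ∧
      0 ≤ Real.logb Λ 114 := by
    refine ⟨?_, ?_, ?_, ?_⟩ <;> exact Real.logb_nonneg hΛ (by norm_num)
  have hl24 : 0 ≤ Real.logb Λ (24 * (J : ℝ) * ((J : ℝ) + 1)) :=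
    Real.logb_nonneg hΛ (by nlinarith only [hJ1])
  have hlP0 : 0 ≤ Real.logb Λ P₀ := Real.logb_nonneg hΛ hP₀
  obtain ⟨m, hmdef⟩ : ∃ m : ℝ, max (t - s₀) 0 = m := ⟨_, rfl⟩
  have hmax0 : 0 ≤ m := by rw [← hmdef]; exact le_max_right _ _
  have hmax1 : t - s₀ ≤ m := by rw [← hmdef]; exact le_max_left _ _
  have hσ' : σ = (12 * ((J : ℝ) + e) + 3 * J + 10) * Real.logb Λ Dτ + ((J : ℝ) ^ 2 + J + 10) * Real.logb Λ 2 +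
      Real.logb Λ ((shapeVal (fun _ : Fin (J + e) => 2) : ℕ) : ℝ) + Real.logb Λ 27 + Real.logb Λ 48 +
      Real.logb Λ 114 + Real.logb Λ (24 * (J : ℝ) * ((J : ℝ) + 1)) + Real.logb Λ P₀ + m := by
    rw [← hσdef, recordSlack, hmdef, hdd]
  have hKD0 : 0 ≤ (12 * ((J : ℝ) + e) + 3 * J + 10) * Real.logb Λ Dτ :=
    mul_nonneg (by linarith only [he0, hJ1]) hlD0
  have hK20 : 0 ≤ ((J : ℝ) ^ 2 + J + 10) * Real.logb Λ 2 := mul_nonneg (by positivity) hl20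
  have hK2 : Real.logb Λ 2 ≤ ((J : ℝ) ^ 2 + J + 10) * Real.logb Λ 2 :=
    le_mul_of_one_le_left hl20 (by nlinarith only [hJ1])
  have hσ0 : 0 ≤ σ := by rw [hσ']; linarith only [hKD0, hK20, hlV0, hl27, hl48, hl114, hl24, hlP0, hmax0]
  /- the first `J` coordinates `Fin.castAdd e k`, `k < J` -/
  have hcast1 : ∀ {k : Fin J}, 1 ≤ (k : ℕ) → 1 ≤ ((Fin.castAdd e k : Fin (J + e)) : ℕ) := fun hk => by
    rwa [Fin.val_castAdd]
  have hkJ : ∀ k : Fin J, ((k : ℕ) : ℝ) + 1 ≤ (J : ℝ) := fun k => by exact_mod_cast Nat.succ_le_of_lt k.is_lt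
  /- the LP variables: exponents `α, β, γ`, totals `A, B, C`, `D`, deficits `da, db, dc`; the structure -/
  obtain ⟨α, hα⟩ : ∃ f : Fin (J + e) → ℝ, expo Λ X = f := ⟨_, rfl⟩
  obtain ⟨β, hβ⟩ : ∃ f : Fin (J + e) → ℝ, expo Λ Y = f := ⟨_, rfl⟩
  obtain ⟨γ, hγ⟩ : ∃ f : Fin (J + e) → ℝ, expo Λ Z = f := ⟨_, rfl⟩
  obtain ⟨A, hA⟩ : ∃ r : ℝ, ∑ i, α i = r := ⟨_, rfl⟩
  obtain ⟨B, hB⟩ : ∃ r : ℝ, ∑ i, β i = r := ⟨_, rfl⟩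
  obtain ⟨C, hC⟩ : ∃ r : ℝ, ∑ i, γ i = r := ⟨_, rfl⟩
  obtain ⟨D, hDn⟩ : ∃ r : ℝ, Real.logb Λ (shapeCount c₁ c₂ c₃ X Y Z) = r := ⟨_, rfl⟩
  obtain ⟨da, hLX⟩ : ∃ r : ℝ, Real.logb Λ ((c₁ * shapeVal X : ℕ) : ℝ) = 1 - r := ⟨_, (sub_sub_cancel 1 _).symm⟩
  obtain ⟨db, hLY⟩ : ∃ r : ℝ, Real.logb Λ ((c₂ * shapeVal Y : ℕ) : ℝ) = 1 - r := ⟨_, (sub_sub_cancel 1 _).symm⟩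
  obtain ⟨dc, hLZ⟩ : ∃ r : ℝ, Real.logb Λ ((c₃ * shapeVal Z : ℕ) : ℝ) = 1 - r := ⟨_, (sub_sub_cancel 1 _).symm⟩
  have hLrad : radExp Λ X Y Z = A + B + C := by
    rw [radExp, sum_add_distrib, sum_add_distrib, hα, hβ, hγ, hA, hB, hC]
  have hdefic : deficiency Λ c₁ c₂ c₃ X Y Z = da + db + dc := by rw [deficiency, hLX, hLY, hLZ]; ring
  obtain ⟨hα0, hTa, hda0, hda1, hWa⟩ := term_facts_castAdd hc₁ hX hΛ hΛdef hvX hα hA hLX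
  obtain ⟨hβ0, hTb, hdb0, hdb1, hWb⟩ := term_facts_castAdd hc₂ hY hΛ hΛdef hvY hβ hB hLY
  obtain ⟨hγ0, hTc, hdc0, -, hWc⟩ := term_facts_castAdd hc₃ hZ hΛ hΛdef hvZ hγ hC hLZ
  -- `dc ≤ σ`: `C₀ ≤ V₂ · c₃ shapeVal Z` and `log_Λ C₀ = 1 − log_Λ 2`
  have hdcσ : dc ≤ σ := by
    have h3 : Real.logb Λ (C₀ : ℝ) ≤ Real.logb Λ ((shapeVal (fun _ : Fin (J + e) => 2) : ℕ) : ℝ) +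
        Real.logb Λ ((c₃ * shapeVal Z : ℕ) : ℝ) := by
      rw [← logb_natMul hV2pos (Nat.mul_pos hc₃ (shapeVal_pos hZ))]
      exact logb_natMono hΛ (by omega) hC₀le
    have h4 : Real.logb Λ (C₀ : ℝ) = 1 - Real.logb Λ 2 := by
      have : (C₀ : ℝ) = Λ / 2 := by rw [hΛdef]; ring
      rw [this, Real.logb_div hΛ0.ne' two_ne_zero, Real.logb_self_eq_one hΛ]
    rw [hLZ] at h3
    linarith only [h3, h4, hσ', hKD0, hK2, hlV0, hl27, hl48, hl114, hl24, hlP0, hmax0]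
  /- the radical: `A + B + C = log_Λ ∏ XᵢYᵢZᵢ ≤ t ≤ s₀ + (t − s₀)₊` -/
  have hL : A + B + C ≤ s₀ + σ := by
    have hp : ∀ i, (0 : ℝ) < X i ∧ (0 : ℝ) < Y i ∧ (0 : ℝ) < Z i := fun i =>
      ⟨by exact_mod_cast hX i, by exact_mod_cast hY i, by exact_mod_cast hZ i⟩
    have hpos : ∀ i, (0 : ℝ) < (X i : ℝ) * Y i * Z i := fun i => by obtain ⟨h1, h2, h3⟩ := hp i; positivity
    have hlog := Real.logb_le_logb_of_le hΛ (prod_pos fun i _ => hpos i) hP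
    rw [Real.logb_rpow hΛ0 hΛ.ne', Real.logb_prod _ _ fun i _ => (hpos i).ne'] at hlog
    have hsum : ∑ i, Real.logb Λ ((X i : ℝ) * Y i * Z i) = A + B + C := by
      rw [← hLrad, radExp]
      refine sum_congr rfl fun i _ => ?_
      obtain ⟨h1, h2, h3⟩ := hp i
      rw [Real.logb_mul (by positivity) h3.ne', Real.logb_mul h1.ne' h2.ne']; rfl
    linarith only [hlog, hsum, hmax1, hσ', hKD0, hK20, hlV0, hl27, hl48, hl114, hl24, hlP0]
  /- the trivial family -/
  obtain ⟨hT1, hT2, hT3⟩ := trivial_linear hc₁ hc₂ hc₃ hX hY hZ hTX hTY hTZ hD hΛ hB0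
  have hd1 : ((J : ℝ) + (e : ℝ)) * Real.logb Λ Dτ ≤ (12 * ((J : ℝ) + e) + 3 * J + 10) * Real.logb Λ Dτ :=
    mul_le_mul_of_nonneg_right (by linarith only [he0, hJ1]) hlD0
  have h_T_ab : D ≤ A + B + σ := by
    rw [hα, hβ, hA, hB, hDn, hdd] at hT1
    linarith only [hT1, hd1, hσ', hK20, hlV0, hl27, hl48, hl114, hl24, hlP0, hmax0]
  have h_T_ac : D ≤ A + C + σ := by
    rw [hα, hγ, hA, hC, hDn, hdd] at hT2
    linarith only [hT2, hd1, hσ', hK20, hlV0, hl27, hl48, hl114, hl24, hlP0, hmax0]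
  have h_T_bc : D ≤ B + C + σ := by
    rw [hβ, hγ, hB, hC, hDn, hdd] at hT3
    linarith only [hT3, hd1, hσ', hK20, hlV0, hl27, hl48, hl114, hl24, hlP0, hmax0]
  /- the determinant family at the coordinates `Fin.castAdd e k`, `1 ≤ k < J` -/
  have hDt : ∀ k : Fin J, 1 ≤ (k : ℕ) →
      D ≤ A + B + C - (α (Fin.castAdd e k) + β (Fin.castAdd e k) + γ (Fin.castAdd e k)) + σ ∨
        D ≤ A + B + C - 1 + ((((k : ℕ) : ℝ) - 1) * (α (Fin.castAdd e k) + β (Fin.castAdd e k) +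
          γ (Fin.castAdd e k)) + (da + db + dc)) / 3 + σ := by
    intro k hk
    have h := det_linear hc₁ hc₂ hc₃ hX hY hZ hDτ hΛ hB0 (Fin.castAdd e k) (hdet (Fin.castAdd e k) (hcast1 hk))
    rw [hLrad, hdefic, hDn, hα, hβ, hγ, Fin.val_castAdd] at h
    have hprod : (((k : ℕ) : ℝ) + 1) * (((k : ℕ) : ℝ) + 2) ≤ (J : ℝ) * ((J : ℝ) + 1) :=
      mul_le_mul (hkJ k) (by linarith only [hkJ k]) (by positivity) (by linarith only [hJ1])
    have hl : Real.logb Λ (24 * ((((k : ℕ) : ℝ) + 1) * (((k : ℕ) : ℝ) + 2))) ≤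
        Real.logb Λ (24 * (J : ℝ) * ((J : ℝ) + 1)) :=
      Real.logb_le_logb_of_le hΛ (by positivity) (by linarith only [hprod])
    have hk' : (3 * ((k : ℕ) : ℝ) + 6) * Real.logb Λ Dτ ≤ (12 * ((J : ℝ) + e) + 3 * J + 10) * Real.logb Λ Dτ :=
      mul_le_mul_of_nonneg_right (by linarith only [hkJ k, he0, hJ1]) hlD0
    exact h.imp (fun h => by linarith only [h, hl, hk', hσ', hK20, hlV0, hl27, hl48, hl114, hlP0, hmax0])
      fun h => by linarith only [h, hl, hk', hσ', hK20, hlV0, hl27, hl48, hl114, hlP0, hmax0]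
  /- the Fourier family: saved finsets mapped along `Fin.castAdd e` -/
  have hmapd : ∀ {S : Finset (Fin J)} {n : ℕ}, (∀ k ∈ S, n ∣ (k : ℕ) + 1) →
      ∀ i ∈ S.map (Fin.castAddEmb e), n ∣ (i : ℕ) + 1 := by
    intro S n hS i hi
    rw [mem_map] at hi
    obtain ⟨k, hk, rfl⟩ := hi
    rw [Fin.castAddEmb_apply, Fin.val_castAdd]
    exact hS k hk
  have hF : ∀ (SU SV SW : Finset (Fin J)) (eU eV eW : ℕ), 2 ≤ eU → 2 ≤ eV → 2 ≤ eW →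
      (∀ k ∈ SU, eU ∣ (k : ℕ) + 1) → (∀ k ∈ SV, eV ∣ (k : ℕ) + 1) → (∀ k ∈ SW, eW ∣ (k : ℕ) + 1) →
      ∑ k ∈ SU, α (Fin.castAdd e k) + ∑ k ∈ SV, β (Fin.castAdd e k) + ∑ k ∈ SW, γ (Fin.castAdd e k) ≤
        4 * (A + B + C) - 6 * D + σ := by
    intro SU SV SW eU eV eW heU heV heW hSU hSV hSW
    have h := fourier_linear hc₁ hc₂ hc₃ hX hY hZ hTX hTY hTZ hD hΛ hB0 (SU.map (Fin.castAddEmb e))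
      (SV.map (Fin.castAddEmb e)) (SW.map (Fin.castAddEmb e)) heU heV heW (hmapd hSU) (hmapd hSV) (hmapd hSW)
    rw [hdd, hα, hβ, hγ, hA, hB, hC, hDn] at h
    simp only [sum_map, Fin.castAddEmb_apply] at h
    have h3 : (12 * ((J : ℝ) + e) + 3) * Real.logb Λ Dτ ≤ (12 * ((J : ℝ) + e) + 3 * J + 10) * Real.logb Λ Dτ :=
      mul_le_mul_of_nonneg_right (by linarith only [hJ1]) hlD0
    linarith only [h, h3, hσ', hK20, hlV0, hl48, hl114, hl24, hlP0, hmax0]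
  /- the subset geometry-of-numbers family: index finsets mapped along `Fin.castAdd e`, weights `≤ J(J+1)/2` each -/
  have hG : ∀ (I J' K : Finset (Fin J)),
      ∑ k ∈ I, α (Fin.castAdd e k) + ∑ k ∈ J', β (Fin.castAdd e k) + ∑ k ∈ K, γ (Fin.castAdd e k) ≤
          A + B + C - D + σ ∨
        1 - (∑ k ∈ I, ((k : ℕ) : ℝ) * α (Fin.castAdd e k) + ∑ k ∈ J', ((k : ℕ) : ℝ) * β (Fin.castAdd e k) +
          ∑ k ∈ K, ((k : ℕ) : ℝ) * γ (Fin.castAdd e k)) ≤ A + B + C - D + σ := by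
    intro I J' K
    have g := geometry_disjunction hc₁ hc₂ hc₃ hX hY hZ hTX hTY hTZ hD hΛ hB0 hC₀ hΛdef hC₀le
      (I.map (Fin.castAddEmb e)) (J'.map (Fin.castAddEmb e)) (K.map (Fin.castAddEmb e)) le_rfl
    rw [hdd, hα, hβ, hγ, hA, hB, hC, hDn] at g
    simp only [sum_map, Fin.castAddEmb_apply, Fin.val_castAdd] at g
    have hI := sum_natCast_succ_le I
    have hJ' := sum_natCast_succ_le J'
    have h2 : (8 + ∑ k ∈ I, (((k : ℕ) : ℝ) + 1) + ∑ k ∈ J', (((k : ℕ) : ℝ) + 1)) * Real.logb Λ 2 ≤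
        ((J : ℝ) ^ 2 + J + 10) * Real.logb Λ 2 :=
      mul_le_mul_of_nonneg_right (by linarith only [hI, hJ']) hl20
    have h3d : 3 * ((J : ℝ) + e) * Real.logb Λ Dτ ≤ (12 * ((J : ℝ) + e) + 3 * J + 10) * Real.logb Λ Dτ :=
      mul_le_mul_of_nonneg_right (by linarith only [he0, hJ1]) hlD0
    exact g.imp (fun g => by linarith only [g, h2, h3d, hσ', hl27, hl48, hl114, hl24, hlP0, hmax0])
      fun g => by linarith only [g, h2, h3d, hσ', hl27, hl48, hl114, hl24, hlP0, hmax0]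
  /- the square-root lattice family: hosts `x` (tool `Q_X`), `y` (`Q_X` on the swapped datum), `z` (`Q_Z`), host
  finsets mapped along `Fin.castAdd e`; the loss `(d + k + 2) log Dτ + log 114` at `k < J` is `≤ σ` -/
  have hQσ : ∀ {k : Fin J} {L1 L2 : ℝ},
      (D ≤ L1 + (((J : ℝ) + e + (k : ℕ) + 2) * Real.logb Λ Dτ + Real.logb Λ 114) ∨
        D ≤ L2 + (((J : ℝ) + e + (k : ℕ) + 2) * Real.logb Λ Dτ + Real.logb Λ 114)) →
      D ≤ L1 + σ ∨ D ≤ L2 + σ := by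
    intro k L1 L2 h
    have h9 : ((J : ℝ) + e + (k : ℕ) + 2) * Real.logb Λ Dτ ≤ (12 * ((J : ℝ) + e) + 3 * J + 10) * Real.logb Λ Dτ :=
      mul_le_mul_of_nonneg_right (by linarith only [he0, hJ1, hkJ k]) hlD0
    exact h.imp (fun h => by linarith only [h, h9, hσ', hK20, hlV0, hl27, hl48, hl24, hlP0, hmax0])
      fun h => by linarith only [h, h9, hσ', hK20, hlV0, hl27, hl48, hl24, hlP0, hmax0]
  have hQa : ∀ (H : Finset (Fin J)) (k : Fin J), 1 ≤ (k : ℕ) →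
      D ≤ A + B + C - (1 - da) + ∑ j ∈ H, ((j : ℕ) : ℝ) * α (Fin.castAdd e j) + σ ∨
        D ≤ A + B + C - (∑ j ∈ H, α (Fin.castAdd e j) + β (Fin.castAdd e k) + γ (Fin.castAdd e k)) + σ := by
    intro H k hk
    have q := sqrtLattice_linear hc₁ hX hY hZ hDτ hΛ hBr (H.map (Fin.castAddEmb e)) (Fin.castAdd e k)
      (hQX hc₁ hc₂ hc₃ X Y Z hX hY hZ hTX hTY hTZ hD (H.map (Fin.castAddEmb e)) (Fin.castAdd e k) (hcast1 hk))
    rw [hα, hβ, hγ, hA, hB, hC, hDn, hLX, hdd] at q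
    simp only [sum_map, Fin.castAddEmb_apply, Fin.val_castAdd] at q
    exact hQσ q
  have hBr' : (0 : ℝ) < shapeCount c₂ c₁ c₃ Y X Z := by rw [← shapeCount_swap c₁ c₂ c₃ X Y Z]; exact hBr
  have hQb : ∀ (H : Finset (Fin J)) (k : Fin J), 1 ≤ (k : ℕ) →
      D ≤ A + B + C - (1 - db) + ∑ j ∈ H, ((j : ℕ) : ℝ) * β (Fin.castAdd e j) + σ ∨
        D ≤ A + B + C - (∑ j ∈ H, β (Fin.castAdd e j) + α (Fin.castAdd e k) + γ (Fin.castAdd e k)) + σ := by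
    intro H k hk
    have q := sqrtLattice_linear hc₂ hY hX hZ hDτ hΛ hBr' (H.map (Fin.castAddEmb e)) (Fin.castAdd e k)
      (hQX hc₂ hc₁ hc₃ Y X Z hY hX hZ hTY hTX hTZ hD (H.map (Fin.castAddEmb e)) (Fin.castAdd e k) (hcast1 hk))
    rw [← shapeCount_swap c₁ c₂ c₃ X Y Z, hα, hβ, hγ, hA, hB, hC, hDn, hLY, hdd] at q
    simp only [sum_map, Fin.castAddEmb_apply, Fin.val_castAdd] at q
    exact (hQσ q).imp (fun h => by linarith only [h]) fun h => by linarith only [h]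
  have hQc : ∀ (H : Finset (Fin J)) (k : Fin J), 1 ≤ (k : ℕ) →
      D ≤ A + B + C - (1 - dc) + ∑ j ∈ H, ((j : ℕ) : ℝ) * γ (Fin.castAdd e j) + σ ∨
        D ≤ A + B + C - (∑ j ∈ H, γ (Fin.castAdd e j) + α (Fin.castAdd e k) + β (Fin.castAdd e k)) + σ := by
    intro H k hk
    have hq' := hQZ hc₁ hc₂ hc₃ X Y Z hX hY hZ hTX hTY hTZ hD (H.map (Fin.castAddEmb e)) (Fin.castAdd e k)
      (hcast1 hk)
    rw [← mul_rotate (subBox (H.map (Fin.castAddEmb e)) Z).card] at hq'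
    have q := sqrtLattice_linear hc₃ hZ hX hY hDτ hΛ hBr (H.map (Fin.castAddEmb e)) (Fin.castAdd e k) hq'
    rw [hα, hβ, hγ, hA, hB, hC, hDn, hLZ, hdd] at q
    simp only [sum_map, Fin.castAddEmb_apply, Fin.val_castAdd] at q
    exact (hQσ q).imp (fun h => by linarith only [h]) fun h => by linarith only [h]
  /- the linear programme -/
  rw [hDn]
  exact hlp (fun k => α (Fin.castAdd e k)) (fun k => β (Fin.castAdd e k)) (fun k => γ (Fin.castAdd e k)) A B C D
    da db dc σ (fun k => hα0 (Fin.castAdd e k)) (fun k => hβ0 (Fin.castAdd e k)) (fun k => hγ0 (Fin.castAdd e k))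
    hTa hTb hTc hWa hda0 hda1 hWb hdb0 hdb1 hWc hdc0 hdcσ hσ0 hσm hL h_T_ab h_T_ac h_T_bc hDt hF hG hQa hQb hQc

end Summit.ABC.ABC.Theorems.MazurKaneLaw

end
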